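import Literature.Barriers.MatrixMultiplication.IrreversibilityBarrierProofs
import Literature.Computability.AlgebraicComplexity.AsymptoticRankMatMul
import HarnessLib

/-!
# `R̃(⟨2,2,2⟩) = 2^ω` — discharge of `BCS1997_ex1524_4`; `ω(⟨2⟩,⟨2,2,2⟩) = ω` unconditionally

Topic `Literature/Barriers/MatrixMultiplication`.  DISCHARGE of the named fact `BCS1997_ex1524_4`
of `IrreversibilityBarrier.lean` (Bürgisser–Clausen–Shokrollahi 1997, Ex. 15.24(4): the asymptotic
rank of the `2 × 2` matrix multiplication tensor is `2^ω`), for every field `K` and the tree's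
`omega K` (`MatrixMultiplicationExponent.lean`) and `asymptoticRank` (`AsymptoticSpectrum.lean`).

It is the case `q = 2` of `asymptoticRank_matMulTensor : R̃(⟨q,q,q⟩) = q^ω` (`q ≥ 1`), proved
in `Literature/Computability/AlgebraicComplexity/AsymptoticRankMatMul.lean` (Alman–Duan–
Vassilevska Williams–Xu–Xu–Zhou 2025, §3.4; BCS 1997, (15.11), Ex. 15.24).  Consequence: the
`ω(⟨2⟩, ⟨2,2,2⟩) = ω` of Christandl–Vrana–Zuiddam 2021, §2.2
(`relativeExponent_unit_matMul_eq_omega`, stated in `IrreversibilityBarrier.lean` under the two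
hypotheses `CVZ2021_relativeExponent_unit`, `BCS1997_ex1524_4`) now holds unconditionally
(`relativeExponent_unit_matMul_eq_omega'`), the first hypothesis being
`CVZ2021_relativeExponent_unit_holds` of `IrreversibilityBarrierProofs.lean`.

No definitions, no new named facts.

## References

* P. Bürgisser, M. Clausen, M. A. Shokrollahi, *Algebraic Complexity Theory*, Springer 1997,
  Ex. 15.24(4) (p. 451). [BurgisserClausenShokrollahi1997]
* M. Christandl, P. Vrana, J. Zuiddam, *Barriers for fast matrix multiplication from
  irreversibility*, Theory of Computing 17 (2021), art. 2 = arXiv:1812.06952, §2.2.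
  [ChristandlVranaZuiddam2021]
* J. Alman, R. Duan, V. Vassilevska Williams, Y. Xu, Z. Xu, R. Zhou, *More asymmetry yields faster
  matrix multiplication*, SODA 2025 = arXiv:2404.16349, §3.4.
  [AlmanDuanVassilevskaWilliamsXuXuZhou2025]
-/

noncomputable section

namespace Literature.Barriers.MatrixMultiplication

/-- **BCS 1997, Ex. 15.24(4), PROVED**: `R̃(⟨2,2,2⟩) = 2^ω` over every field — discharge of
the named fact `BCS1997_ex1524_4` (the case `q = 2` of `asymptoticRank_matMulTensor`).
[cite: BurgisserClausenShokrollahi1997, Ex. 15.24(4)] -/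
theorem BCS1997_ex1524_4_holds : BCS1997_ex1524_4 := by
  intro K _
  exact_mod_cast
    Literature.Computability.AlgebraicComplexity.asymptoticRank_matMulTensor K 2 (by norm_num)

/-- **`ω(⟨2⟩, ⟨2,2,2⟩) = ω` unconditionally** (CVZ 2021, §2.2: "by definition of the matrix
multiplication exponent"), for the tree's infimum formalisation of relative exponents and every
field. [cite: ChristandlVranaZuiddam2021, §2.2] -/
theorem relativeExponent_unit_matMul_eq_omega' (K : Type) [Field K] :
    Literature.Computability.AlgebraicComplexity.relativeExponent
        (Literature.Computability.AlgebraicComplexity.unitTensor K 2)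
        (Literature.Computability.AlgebraicComplexity.matMulTensor K 2 2 2) =
      Literature.Computability.AlgebraicComplexity.omega K :=
  relativeExponent_unit_matMul_eq_omega CVZ2021_relativeExponent_unit_holds
    BCS1997_ex1524_4_holds K

end Literature.Barriers.MatrixMultiplication

end
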